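import Summits.FinalStateConjecture.FinalStateConjecture.Theses.ZeroEnergyKerrOrBomb

/-!
# `ZeroEnergyRigidity` (crux `stmt-FinalStateConjecture-10690`): h3 fixes neither the orientation nor the scale of its Killing field

Negative-lane load-bearing analysis for hypothesis h3 = `𝓑.toSpacetime.IsNonDegenerateHorizon 𝓑.Mext`
of the crux `ZeroEnergyRigidity` (route `ZeroEnergyKerrOrBomb`; cdisprove seat, cycle 2).
h3 reads `∃ K, Killing K ∧ K ≠ 0 on 𝓔⁺ ∧ (integral curves from 𝓔⁺ stay in 𝓔⁺) ∧ ∃ κ ≠ 0,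
∇_K K = κ K on 𝓔⁺`.

* `isKillingField_const_smul`: constant multiples of Killing fields are Killing fields;
* `isNonDegenerateHorizon_witness_smul`: if `(K, κ)` witnesses h3 then so does `(c • K, c κ)`
  for every `c ≠ 0` (integral curves of `c • K` are reparametrised integral curves of `K`,
  `IsMIntegralCurve.comp_mul`; `∇_{cK}(cK) = c² ∇_K K`);
* `isNonDegenerateHorizon_iff_exists_pos_kappa` / `…_neg_kappa`: hence h3 is equivalent to h3
  with `0 < κ` and to h3 with `κ < 0`.

So the unoriented surface gravity of the telescope carries exactly the bit `κ ≠ 0`: neither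
"the generator `K` is future-directed" nor "`κ > 0`" nor any normalisation of `K` against the
stationary field is a reading of h3 — a collar / Hawking-step argument must first orient `K`
(free: `c = −1`) and then PROVE the oriented sign.

References: P. T. Chruściel, J. L. Costa, Astérisque 321 (2008), §2.3–2.5 (Killing horizons,
surface gravity); B. O'Neill, *Semi-Riemannian geometry*, 1983, Ch. 9, Prop. 9.25.
-/

namespace Summit.FinalStateConjecture.FinalStateConjecture.Theorems.ZeroEnergyRigidity.Negative

open Literature.Geometry.Lorentzian
open scoped Manifold ContDiff

universe u

variable (𝓑 : StationaryAFBlackHole.{u}) [𝓑.metric.HasLeviCivita]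

/-- **Constant multiples of Killing fields are Killing fields**: `∇(c • K) = c • ∇K`
(`IsCovariantDerivativeOn.smul_const` at the `C^∞` section `K`) and the Killing equation is
linear. O'Neill 1983, Ch. 9, Prop. 9.25 (the Killing fields form a real vector space).
[cite: ONeill1983, Ch. 9, Prop. 9.25] -/
theorem isKillingField_const_smul {K : Π x : 𝓑.carrier, TangentSpace (𝓡 4) x}
    (hK : 𝓑.metric.IsKillingField K) (c : ℝ) : 𝓑.metric.IsKillingField (c • K) := by
  refine ⟨hK.contMDiff.const_smul_section, fun x Y₀ Z₀ ↦ ?_⟩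
  have hKx : MDifferentiableAt (𝓡 4) (𝓡 4).tangent
      (fun y ↦ (⟨y, K y⟩ : TangentBundle (𝓡 4) 𝓑.carrier)) x :=
    (hK.contMDiff x).mdifferentiableAt (by simp)
  have hs : 𝓑.metric.leviCivita (c • K) x = c • 𝓑.metric.leviCivita K x :=
    𝓑.metric.leviCivita.isCovariantDerivativeOnUniv.smul_const c hKx
  have h := hK.val_leviCivita_add x Y₀ Z₀
  simp only [hs, FunLike.coe_smul, Pi.smul_apply, map_smul, smul_eq_mul]
  linear_combination c * h

/-- **If `(K, κ)` witnesses h3 then so does `(c • K, c κ)`, `c ≠ 0`**: the four clauses of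
`IsNonDegenerateHorizon` transported along `K ↦ c • K` (Killing by
`isKillingField_const_smul`; non-vanishing; tangency via the reparametrised integral curves
`γ ∘ (· * c⁻¹)` of `K`; `∇_{cK}(cK) = c²κ K = (cκ)(cK)`). Chruściel–Costa 2008, §2.3 ((2.8):
`κ` scales with the normalisation of the Killing field). [cite: ChruscielCosta2008, §2.3 (2.8)] -/
theorem isNonDegenerateHorizon_witness_smul {K : Π x : 𝓑.carrier, TangentSpace (𝓡 4) x} {κ : ℝ}
    (hK : 𝓑.metric.IsKillingField K) (hne : ∀ p ∈ 𝓑.horizon, K p ≠ 0)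
    (htan : ∀ γ : ℝ → 𝓑.carrier, IsMIntegralCurve γ K → γ 0 ∈ 𝓑.horizon → ∀ t, γ t ∈ 𝓑.horizon)
    (hgeod : ∀ p ∈ 𝓑.horizon, 𝓑.metric.leviCivita K p (K p) = κ • K p) {c : ℝ} (hc : c ≠ 0) :
    𝓑.metric.IsKillingField (c • K) ∧ (∀ p ∈ 𝓑.horizon, (c • K) p ≠ 0) ∧
      (∀ γ : ℝ → 𝓑.carrier, IsMIntegralCurve γ (c • K) → γ 0 ∈ 𝓑.horizon →
        ∀ t, γ t ∈ 𝓑.horizon) ∧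
      ∀ p ∈ 𝓑.horizon, 𝓑.metric.leviCivita (c • K) p ((c • K) p) = (c * κ) • (c • K) p := by
  refine ⟨isKillingField_const_smul 𝓑 hK c, fun p hp ↦ ?_, fun γ hγ h0 t ↦ ?_, fun p hp ↦ ?_⟩
  · simpa [hc] using hne p hp
  · have hγ' : IsMIntegralCurve (γ ∘ (· * c⁻¹)) K := by
      simpa [smul_smul, inv_mul_cancel₀ hc] using hγ.comp_mul c⁻¹
    have h := htan _ hγ' (by simpa using h0) (t * c)
    simpa [mul_assoc, mul_inv_cancel₀ hc] using h
  · have hKx : MDifferentiableAt (𝓡 4) (𝓡 4).tangent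
        (fun y ↦ (⟨y, K y⟩ : TangentBundle (𝓡 4) 𝓑.carrier)) p :=
      (hK.contMDiff p).mdifferentiableAt (by simp)
    have hs : 𝓑.metric.leviCivita (c • K) p = c • 𝓑.metric.leviCivita K p :=
      𝓑.metric.leviCivita.isCovariantDerivativeOnUniv.smul_const c hKx
    rw [hs, Pi.smul_apply, FunLike.coe_smul, Pi.smul_apply, map_smul, hgeod p hp,
      smul_smul, smul_smul, smul_smul]
    congr 1
    ring

/-- **h3 is equivalent to h3 with a POSITIVE surface gravity** (reverse the witness, `c = −1`, if
`κ < 0`): the telescope's `κ` carries only the bit `κ ≠ 0`. [cite: ChruscielCosta2008, §2.5] -/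
theorem isNonDegenerateHorizon_iff_exists_pos_kappa :
    𝓑.toSpacetime.IsNonDegenerateHorizon 𝓑.Mext ↔
      ∃ K : Π x : 𝓑.carrier, TangentSpace (𝓡 4) x, 𝓑.metric.IsKillingField K ∧
        (∀ p ∈ 𝓑.horizon, K p ≠ 0) ∧
        (∀ γ : ℝ → 𝓑.carrier, IsMIntegralCurve γ K → γ 0 ∈ 𝓑.horizon → ∀ t, γ t ∈ 𝓑.horizon) ∧
        ∃ κ : ℝ, 0 < κ ∧ ∀ p ∈ 𝓑.horizon, 𝓑.metric.leviCivita K p (K p) = κ • K p := by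
  constructor
  · rintro ⟨K, hK, hne, htan, κ, hκ, hgeod⟩
    rcases lt_or_gt_of_ne hκ with hneg | hpos
    · obtain ⟨hK', hne', htan', hgeod'⟩ := isNonDegenerateHorizon_witness_smul 𝓑 hK hne htan
        hgeod (neg_ne_zero.2 one_ne_zero : (-1 : ℝ) ≠ 0)
      exact ⟨(-1 : ℝ) • K, hK', hne', htan', -1 * κ, by linarith, hgeod'⟩
    · exact ⟨K, hK, hne, htan, κ, hpos, hgeod⟩
  · rintro ⟨K, hK, hne, htan, κ, hκ, hgeod⟩
    exact ⟨K, hK, hne, htan, κ, hκ.ne', hgeod⟩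

/-- **h3 is equivalent to h3 with a NEGATIVE surface gravity** (same reversal). [cite: ChruscielCosta2008, §2.5] -/
theorem isNonDegenerateHorizon_iff_exists_neg_kappa :
    𝓑.toSpacetime.IsNonDegenerateHorizon 𝓑.Mext ↔
      ∃ K : Π x : 𝓑.carrier, TangentSpace (𝓡 4) x, 𝓑.metric.IsKillingField K ∧
        (∀ p ∈ 𝓑.horizon, K p ≠ 0) ∧
        (∀ γ : ℝ → 𝓑.carrier, IsMIntegralCurve γ K → γ 0 ∈ 𝓑.horizon → ∀ t, γ t ∈ 𝓑.horizon) ∧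
        ∃ κ : ℝ, κ < 0 ∧ ∀ p ∈ 𝓑.horizon, 𝓑.metric.leviCivita K p (K p) = κ • K p := by
  rw [isNonDegenerateHorizon_iff_exists_pos_kappa]
  constructor
  · rintro ⟨K, hK, hne, htan, κ, hκ, hgeod⟩
    obtain ⟨hK', hne', htan', hgeod'⟩ := isNonDegenerateHorizon_witness_smul 𝓑 hK hne htan
      hgeod (neg_ne_zero.2 one_ne_zero : (-1 : ℝ) ≠ 0)
    exact ⟨(-1 : ℝ) • K, hK', hne', htan', -1 * κ, by linarith, hgeod'⟩
  · rintro ⟨K, hK, hne, htan, κ, hκ, hgeod⟩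
    obtain ⟨hK', hne', htan', hgeod'⟩ := isNonDegenerateHorizon_witness_smul 𝓑 hK hne htan
      hgeod (neg_ne_zero.2 one_ne_zero : (-1 : ℝ) ≠ 0)
    exact ⟨(-1 : ℝ) • K, hK', hne', htan', -1 * κ, by linarith, hgeod'⟩

end Summit.FinalStateConjecture.FinalStateConjecture.Theorems.ZeroEnergyRigidity.Negative
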